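import Summits.CriticalPhenomena.PercolationContinuityZ3.Theorems.Transplant.Slab111HubXForm
import Summits.CriticalPhenomena.PercolationContinuityZ3.Theorems.Transplant.Slab111HubCheck
import Summits.CriticalPhenomena.PercolationContinuityZ3.Theorems.Transplant.Slab111HubShape
import HarnessLib

/-!
# The HUB ROUTING of the `(111)`-films, XXVIII-X: zone-free table ENTRIES, their static checks and level formulas, with soundness

builds on p205010 (kernel theorem, internal audit signed; external expert review pending) — NOT used in this file.  Lane `prim-bschramm`, seat
`prim-bschramm-p2` (gen 37; class C1b; memo `HOME/bschramm/P2-LATTICES.md` §135); helper file (`--supports stmt-CriticalPhenomena-4575 --as helper`).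
An ENTRY of the zone-free dispatcher (`EntryX`, §1): three faces with attachment directions, the direction `τ` and the OFFSET `a` of the lower
hub level from the level of `E₁` (`LA = n₁ + a`, `LD = LA + 3τ`), three relative legs.  §2: the level-independent conditions of a hub plan as
one Boolean `EntryX.staticB` (faces, regions, legs, `e₁` before the attachment).  §3: the level-dependent conditions as «Slab111HubXLang»
formulas, part by part (hub levels in `[1, k−1]`, attachment and leg memberships, separations from the exact ride windows, hub avoidance,
distinctness), each with its SOUNDNESS at the pattern of a configuration (§4): a true part gives the corresponding family of level facts.
«Slab111HubXPlanOf» assembles the `HubPlanX`.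
[cite: DuminilCopinSidoraviciusTassion2016, §2.3 (proof of Fact 2: the three disjoint paths γ_u, γ_v, γ_w in B_R(z))]
-/

namespace Summit.CriticalPhenomena.PercolationContinuityZ3.Theorems.Transplant

namespace Slab111

/-! ## §1 Entries -/

/-- **A zone-free table entry.** [folklore] -/
structure EntryX where
  (F1 F2 F3 : FaceD)
  (d₁ d₂ d₃ : ℤ)
  /-- direction from `H_A` to `H_D`, and the offset `LA − n₁` -/
  (τ a : ℤ)
  (l₁ l₂ l₃ : List MV)
  deriving DecidableEq, Repr

/-- The last element of a relative leg (default the terminal itself). [folklore] -/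
def lastD (l : List MV) : MV := l.getLast?.getD (((0 : ℤ), (0 : ℤ)), (0 : ℤ))

/-- For a nonempty list `lastD` is `getLast`. [folklore] -/
theorem lastD_eq {l : List MV} (h : l ≠ []) : lastD l = l.getLast h := by
  unfold lastD; rw [List.getLast?_eq_some_getLast h]; rfl

/-- A member other than the last lies in `dropLast`. [folklore] -/
theorem mem_dropLast_of_ne {l : List MV} {p : MV} (h : l ≠ []) (hp : p ∈ l) (hne : p ≠ l.getLast h) : p ∈ l.dropLast := by
  have e := List.dropLast_append_getLast h
  rw [← e, List.mem_append, List.mem_singleton] at hp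
  exact hp.resolve_right hne

/-- A member other than the head lies in `tail`. [folklore] -/
theorem mem_tail_of_ne {l : List MV} {p h0 : MV} (hh : l.head? = some h0) (hp : p ∈ l) (hne : p ≠ h0) : p ∈ l.tail := by
  cases l with
  | nil => simp at hp
  | cons a t =>
    simp only [List.head?_cons, Option.some.injEq] at hh
    subst hh
    simpa [List.mem_cons, hne] using hp

namespace EntryX

variable (S : ShapeB) (e : EntryX) (q₁ q₂ q₃ : ℤ × ℤ)

/-- The attachment column of a face in direction `d`. [folklore] -/
def attCol (F : FaceD) (d : ℤ) : ℤ × ℤ := if d = 1 then F.f1 else F.f2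

/-! ## §2 The static checks -/

/-- **The level-independent conditions** of the hub plan of an entry at terminal columns `q₁, q₂, q₃`. [folklore] -/
def staticB : Bool :=
  faceOkB e.F1 && faceOkB e.F2 && faceOkB e.F3 && offHubB e.F1 && offHubB e.F2 && offHubB e.F3 &&
  disjB e.F1 e.F2 && disjB e.F1 e.F3 && disjB e.F2 e.F3 && attB e.F1 e.d₁ && attB e.F2 e.d₂ && attB e.F3 e.d₃ &&
  (S.pcB e.F1.f0 && S.pcB e.F1.f1 && S.pcB e.F1.f2) && (S.pcB e.F2.f0 && S.pcB e.F2.f1 && S.pcB e.F2.f2) &&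
  (S.colsB e.F3.f0 && S.colsB e.F3.f1 && S.colsB e.F3.f2) && S.pcB (0, 0) &&
  (e.τ == 1 || e.τ == -1) && ((e.a + (q₁.1 + 2 * q₁.2)) % 3 == 0) &&
  legOKB e.l₁ && legOKB e.l₂ && legOKB e.l₃ &&
  faceMemB e.F1 (q₁ + (lastD e.l₁).1) && faceMemB e.F2 (q₂ + (lastD e.l₂).1) && faceMemB e.F3 (q₃ + (lastD e.l₃).1) &&
  e.l₁.dropLast.all (fun p => !faceMemB e.F1 (q₁ + p.1)) && e.l₂.dropLast.all (fun p => !faceMemB e.F2 (q₂ + p.1)) &&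
  e.l₃.dropLast.all (fun p => !faceMemB e.F3 (q₃ + p.1)) &&
  e.l₁.tail.all (fun p => S.pcB (q₁ + p.1)) && e.l₂.tail.all (fun p => S.pcB (q₂ + p.1)) && e.l₃.tail.all (fun p => S.colsB (q₃ + p.1)) &&
  decide (0 ≤ e.τ * (e.a + e.d₁ - (lastD e.l₁).2))

/-! ## §3 The level formulas -/

/-- Hub levels in `[1, k−1]`. [folklore] -/
def hubQ : List (List Atom) :=
  [[ge0A 1 (e.a - 1)], [leKA 1 (e.a + 1)], [ge0A 1 (e.a + 3 * e.τ - 1)], [leKA 1 (e.a + 3 * e.τ + 1)]]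

/-- Membership of the five attachment vertices. [folklore] -/
def attFm : Fm :=
  [[memQ 1 (e.a + 3 * e.τ + e.d₁) (S.badBot (attCol e.F1 e.d₁)) (S.badTop (attCol e.F1 e.d₁))],
   [memQ 1 (e.a + e.d₂) (S.badBot (attCol e.F2 e.d₂)) (S.badTop (attCol e.F2 e.d₂))],
   [memQ 1 (e.a + 3 * e.τ + e.d₂) (S.badBot (attCol e.F2 e.d₂)) (S.badTop (attCol e.F2 e.d₂))],
   [memQ 1 (e.a + e.d₃) (S.badBot (attCol e.F3 e.d₃)) (S.badTop (attCol e.F3 e.d₃))],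
   [memQ 1 (e.a + 3 * e.τ + e.d₃) (S.badBot (attCol e.F3 e.d₃)) (S.badTop (attCol e.F3 e.d₃))]]

/-- Membership of the non-terminal vertices of leg `i` (terminal column `q`, relative leg `l`). [folklore] -/
def memFmLeg (i : ℕ) (q : ℤ × ℤ) (l : List MV) : Fm :=
  l.tail.map fun p => [memQ i p.2 (S.badBot (q + p.1)) (S.badTop (q + p.1))]

/-- The lower and upper window ends of face `j` as level terms. [folklore] -/
def winLo (j : ℕ) : List LvT :=
  if j = 1 then [(1, (lastD e.l₁).2), (1, e.a + 3 * e.τ + e.d₁)]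
  else if j = 2 then [(2, (lastD e.l₂).2), (1, min e.a (e.a + 3 * e.τ) + e.d₂)]
  else [(3, (lastD e.l₃).2), (1, min e.a (e.a + 3 * e.τ) + e.d₃)]
/-- The upper window ends of face `j`. [folklore] -/
def winHi (j : ℕ) : List LvT :=
  if j = 1 then [(1, (lastD e.l₁).2), (1, e.a + 3 * e.τ + e.d₁)]
  else if j = 2 then [(2, (lastD e.l₂).2), (1, max e.a (e.a + 3 * e.τ) + e.d₂)]
  else [(3, (lastD e.l₃).2), (1, max e.a (e.a + 3 * e.τ) + e.d₃)]

/-- The face of index `j`. [folklore] -/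
def face (j : ℕ) : FaceD := if j = 1 then e.F1 else if j = 2 then e.F2 else e.F3

/-- Separation of the non-last vertices of leg `i` from the window of face `j`. [folklore] -/
def sepFmLeg (i j : ℕ) (q : ℤ × ℤ) (l : List MV) : Fm :=
  l.dropLast.flatMap fun p => if faceMemB (e.face j) (q + p.1) then [[ltMinQ (i, p.2) (e.winLo j), gtMaxQ (i, p.2) (e.winHi j)]] else []

/-- Hub avoidance of the non-last vertices of leg `i`. [folklore] -/
def hubAvoidFmLeg (i : ℕ) (q : ℤ × ℤ) (l : List MV) : Fm :=
  l.dropLast.flatMap fun p => if q + p.1 = (0, 0) then [[neQ (i, p.2) (1, e.a) ++ neQ (i, p.2) (1, e.a + 3 * e.τ)]] else []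

/-- Distinctness of the non-last vertices of legs `i` and `j`. [folklore] -/
def distFmLegs (i j : ℕ) (qi qj : ℤ × ℤ) (li lj : List MV) : Fm :=
  li.dropLast.flatMap fun p => lj.dropLast.flatMap fun p' => if qi + p.1 = qj + p'.1 then [[neQ (i, p.2) (j, p'.2)]] else []

/-- **The level formula of an entry** at terminal columns `q₁, q₂, q₃`. [folklore] -/
def fm : Fm :=
  [[e.hubQ]] ++ e.attFm S ++ (memFmLeg S 1 q₁ e.l₁ ++ memFmLeg S 2 q₂ e.l₂ ++ memFmLeg S 3 q₃ e.l₃) ++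
  (e.sepFmLeg 1 2 q₁ e.l₁ ++ e.sepFmLeg 1 3 q₁ e.l₁ ++ e.sepFmLeg 2 1 q₂ e.l₂ ++ e.sepFmLeg 2 3 q₂ e.l₂ ++ e.sepFmLeg 3 1 q₃ e.l₃ ++
    e.sepFmLeg 3 2 q₃ e.l₃) ++
  (e.hubAvoidFmLeg 1 q₁ e.l₁ ++ e.hubAvoidFmLeg 2 q₂ e.l₂ ++ e.hubAvoidFmLeg 3 q₃ e.l₃) ++
  (distFmLegs 1 2 q₁ q₂ e.l₁ e.l₂ ++ distFmLegs 1 3 q₁ q₃ e.l₁ e.l₃ ++ distFmLegs 2 3 q₂ q₃ e.l₂ e.l₃)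

/-- **Acceptance of an entry at a pattern.** [folklore] -/
def acc (p : Pat) : Bool := e.staticB S q₁ q₂ q₃ && (e.fm S q₁ q₂ q₃).eval p

/-! ## §4 Soundness of the parts -/

/-- `Fm.eval` of an append. [folklore] -/
theorem eval_append (p : Pat) (f g : Fm) : Fm.eval p (f ++ g) = (Fm.eval p f && Fm.eval p g) := by
  unfold Fm.eval; rw [List.all_append]

/-- A single-cube conjunct of a true formula is a true cube. [folklore] -/
theorem evalQ_of_mem {p : Pat} {f : Fm} (h : Fm.eval p f = true) {Q : List (List Atom)} (hQ : [Q] ∈ f) : evalQ p Q = true := by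
  unfold Fm.eval at h; rw [List.all_eq_true] at h
  have := h _ hQ
  unfold evalD at this; simpa using this

section Sound

variable {S e q₁ q₂ q₃}
variable {n₁ n₂ n₃ k : ℤ} (h1 : 0 ≤ n₁ ∧ n₁ ≤ k) (h2 : 0 ≤ n₂ ∧ n₂ ≤ k) (h3 : 0 ≤ n₃ ∧ n₃ ≤ k)
include h1 h2 h3

/-- **Soundness of `hubQ`**: the hub levels `LA = n₁ + a`, `LD = LA + 3τ` lie in `[1, k−1]`. [folklore] -/
theorem hubQ_sound (h : evalQ (patOf n₁ n₂ n₃ k) e.hubQ = true) :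
    1 ≤ n₁ + e.a ∧ n₁ + e.a ≤ k - 1 ∧ 1 ≤ n₁ + e.a + 3 * e.τ ∧ n₁ + e.a + 3 * e.τ ≤ k - 1 := by
  unfold hubQ evalQ evalC at h
  simp only [List.all_cons, List.all_nil, List.any_cons, List.any_nil, Bool.or_false, Bool.and_true, Bool.and_eq_true] at h
  obtain ⟨ha, hb, hc, hd⟩ := h
  obtain ⟨s1, s2, -⟩ := bdry_sound h1 h2 h3 (i := 1) (Or.inl rfl) (e.a - 1)
  obtain ⟨-, s4, -⟩ := bdry_sound h1 h2 h3 (i := 1) (Or.inl rfl) (e.a + 1)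
  obtain ⟨s5, -, -⟩ := bdry_sound h1 h2 h3 (i := 1) (Or.inl rfl) (e.a + 3 * e.τ - 1)
  obtain ⟨-, s8, -⟩ := bdry_sound h1 h2 h3 (i := 1) (Or.inl rfl) (e.a + 3 * e.τ + 1)
  have t1 := s1 ha; have t2 := s4 hb; have t3 := s5 hc; have t4 := s8 hd
  unfold LvT.val at t1 t2 t3 t4; simp only [if_true] at t1 t2 t3 t4
  omega

/-- The level facts of a membership cube, spelled out for a column `c`. [folklore] -/
def MemFacts (S : ShapeB) (k : ℤ) (c : ℤ × ℤ) (L : ℤ) : Prop :=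
  0 ≤ L ∧ L ≤ k ∧ (L = 0 → S.badBot c = false) ∧ (L = k → S.badTop c = false)

omit h1 h2 h3 in
/-- From `memQ_sound`'s conclusion to `MemFacts`. [folklore] -/
theorem memFacts_of {c : ℤ × ℤ} {L : ℤ} (h : 0 ≤ L ∧ L ≤ k ∧ (S.badBot c = true → L ≠ 0) ∧ (S.badTop c = true → L ≠ k)) :
    MemFacts S k c L := by
  refine ⟨h.1, h.2.1, fun hL => ?_, fun hL => ?_⟩
  · cases hb : S.badBot c
    · rfl
    · exact absurd hL (h.2.2.1 hb)
  · cases hb : S.badTop c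
    · rfl
    · exact absurd hL (h.2.2.2 hb)

/-- **Soundness of `attFm`**: the five attachment levels satisfy the membership facts over their columns. [folklore] -/
theorem attFm_sound (h : Fm.eval (patOf n₁ n₂ n₃ k) (e.attFm S) = true) :
    MemFacts S k (attCol e.F1 e.d₁) (n₁ + e.a + 3 * e.τ + e.d₁) ∧ MemFacts S k (attCol e.F2 e.d₂) (n₁ + e.a + e.d₂) ∧
    MemFacts S k (attCol e.F2 e.d₂) (n₁ + e.a + 3 * e.τ + e.d₂) ∧ MemFacts S k (attCol e.F3 e.d₃) (n₁ + e.a + e.d₃) ∧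
    MemFacts S k (attCol e.F3 e.d₃) (n₁ + e.a + 3 * e.τ + e.d₃) := by
  have g := fun (x : ℤ) (c : ℤ × ℤ) (hQ : [memQ 1 x (S.badBot c) (S.badTop c)] ∈ e.attFm S) =>
    memFacts_of (S := S) (by
      have := memQ_sound h1 h2 h3 (i := 1) (Or.inl rfl) (evalQ_of_mem h hQ)
      unfold LvT.val at this; simp only [if_true] at this; exact this)
  unfold attFm at g
  refine ⟨?_, ?_, ?_, ?_, ?_⟩
  · have := g (e.a + 3 * e.τ + e.d₁) (attCol e.F1 e.d₁) (by simp); rwa [show n₁ + e.a + 3 * e.τ + e.d₁ = n₁ + (e.a + 3 * e.τ + e.d₁) by ring]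
  · have := g (e.a + e.d₂) (attCol e.F2 e.d₂) (by simp); rwa [show n₁ + e.a + e.d₂ = n₁ + (e.a + e.d₂) by ring]
  · have := g (e.a + 3 * e.τ + e.d₂) (attCol e.F2 e.d₂) (by simp); rwa [show n₁ + e.a + 3 * e.τ + e.d₂ = n₁ + (e.a + 3 * e.τ + e.d₂) by ring]
  · have := g (e.a + e.d₃) (attCol e.F3 e.d₃) (by simp); rwa [show n₁ + e.a + e.d₃ = n₁ + (e.a + e.d₃) by ring]
  · have := g (e.a + 3 * e.τ + e.d₃) (attCol e.F3 e.d₃) (by simp); rwa [show n₁ + e.a + 3 * e.τ + e.d₃ = n₁ + (e.a + 3 * e.τ + e.d₃) by ring]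

/-- **Soundness of `memFmLeg`**: every vertex of the tail of the leg satisfies the membership facts. [folklore] -/
theorem memFmLeg_sound {i : ℕ} (hi : i = 1 ∨ i = 2 ∨ i = 3) {q : ℤ × ℤ} {l : List MV} (h : Fm.eval (patOf n₁ n₂ n₃ k) (memFmLeg S i q l) = true) :
    ∀ p ∈ l.tail, MemFacts S k (q + p.1) (LvT.val n₁ n₂ n₃ (i, p.2)) := by
  intro p hp
  refine memFacts_of (memQ_sound h1 h2 h3 hi (evalQ_of_mem h ?_))
  unfold memFmLeg; exact List.mem_map.2 ⟨p, hp, rfl⟩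

omit h1 h2 h3 in
/-- The indices of the window terms are terminal indices. [folklore] -/
theorem win_idx (j : ℕ) : (∀ B ∈ e.winLo j, B.1 = 1 ∨ B.1 = 2 ∨ B.1 = 3) ∧ (∀ B ∈ e.winHi j, B.1 = 1 ∨ B.1 = 2 ∨ B.1 = 3) := by
  unfold winLo winHi
  constructor <;> intro B hB <;> split_ifs at hB <;> simp only [List.mem_cons, List.mem_nil_iff, or_false] at hB <;>
    rcases hB with rfl | rfl <;> simp

/-- **Soundness of `sepFmLeg`**: a non-last vertex of leg `i` over a column of face `j` lies below every lower window end or above every upper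
window end of face `j`. [folklore] -/
theorem sepFmLeg_sound {i j : ℕ} (hi : i = 1 ∨ i = 2 ∨ i = 3) {q : ℤ × ℤ} {l : List MV}
    (h : Fm.eval (patOf n₁ n₂ n₃ k) (e.sepFmLeg i j q l) = true) :
    ∀ p ∈ l.dropLast, (e.face j).mem (q + p.1) →
      (∀ B ∈ e.winLo j, LvT.val n₁ n₂ n₃ (i, p.2) < LvT.val n₁ n₂ n₃ B) ∨ (∀ B ∈ e.winHi j, LvT.val n₁ n₂ n₃ B < LvT.val n₁ n₂ n₃ (i, p.2)) := by
  intro p hp hmem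
  have hm : [ltMinQ (i, p.2) (e.winLo j), gtMaxQ (i, p.2) (e.winHi j)] ∈ e.sepFmLeg i j q l := by
    unfold sepFmLeg; refine List.mem_flatMap.2 ⟨p, hp, ?_⟩
    rw [if_pos ((faceMemB_iff _ _).2 hmem)]; simp
  unfold Fm.eval at h; rw [List.all_eq_true] at h
  have hd := h _ hm
  unfold evalD at hd
  simp only [List.any_cons, List.any_nil, Bool.or_false, Bool.or_eq_true] at hd
  rcases hd with hd | hd
  · exact Or.inl (ltMinQ_sound h1 h2 h3 hi (e.win_idx j).1 hd)
  · exact Or.inr (gtMaxQ_sound h1 h2 h3 hi (e.win_idx j).2 hd)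

/-- **Soundness of `hubAvoidFmLeg`**: a non-last vertex of leg `i` over the hub column is not at a hub level. [folklore] -/
theorem hubAvoidFmLeg_sound {i : ℕ} (hi : i = 1 ∨ i = 2 ∨ i = 3) {q : ℤ × ℤ} {l : List MV}
    (h : Fm.eval (patOf n₁ n₂ n₃ k) (e.hubAvoidFmLeg i q l) = true) :
    ∀ p ∈ l.dropLast, q + p.1 = (0, 0) → LvT.val n₁ n₂ n₃ (i, p.2) ≠ n₁ + e.a ∧ LvT.val n₁ n₂ n₃ (i, p.2) ≠ n₁ + e.a + 3 * e.τ := by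
  intro p hp hq
  have hm : [neQ (i, p.2) (1, e.a) ++ neQ (i, p.2) (1, e.a + 3 * e.τ)] ∈ e.hubAvoidFmLeg i q l := by
    unfold hubAvoidFmLeg; refine List.mem_flatMap.2 ⟨p, hp, ?_⟩
    rw [if_pos hq]; simp
  have hQ := evalQ_of_mem h hm
  rw [evalQ_append, Bool.and_eq_true] at hQ
  have a1 := neQ_sound h1 h2 h3 hi (B := (1, e.a)) (Or.inl rfl) hQ.1
  have a2 := neQ_sound h1 h2 h3 hi (B := (1, e.a + 3 * e.τ)) (Or.inl rfl) hQ.2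
  have v1 : LvT.val n₁ n₂ n₃ (1, e.a) = n₁ + e.a := by unfold LvT.val; simp
  have v2 : LvT.val n₁ n₂ n₃ (1, e.a + 3 * e.τ) = n₁ + e.a + 3 * e.τ := by unfold LvT.val; simp only [if_true]; ring
  rw [v1] at a1; rw [v2] at a2
  exact ⟨a1, a2⟩

/-- **Soundness of `distFmLegs`**: non-last vertices of legs `i`, `j` over the same column have different levels. [folklore] -/
theorem distFmLegs_sound {i j : ℕ} (hi : i = 1 ∨ i = 2 ∨ i = 3) (hj : j = 1 ∨ j = 2 ∨ j = 3) {qi qj : ℤ × ℤ} {li lj : List MV}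
    (h : Fm.eval (patOf n₁ n₂ n₃ k) (distFmLegs i j qi qj li lj) = true) :
    ∀ p ∈ li.dropLast, ∀ p' ∈ lj.dropLast, qi + p.1 = qj + p'.1 → LvT.val n₁ n₂ n₃ (i, p.2) ≠ LvT.val n₁ n₂ n₃ (j, p'.2) := by
  intro p hp p' hp' hq
  have hm : [neQ (i, p.2) (j, p'.2)] ∈ distFmLegs i j qi qj li lj := by
    unfold distFmLegs
    refine List.mem_flatMap.2 ⟨p, hp, List.mem_flatMap.2 ⟨p', hp', ?_⟩⟩
    rw [if_pos hq]; simp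
  exact neQ_sound h1 h2 h3 hi hj (evalQ_of_mem h hm)

end Sound

end EntryX

end Slab111

end Summit.CriticalPhenomena.PercolationContinuityZ3.Theorems.Transplant
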